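import Literature.AnabelianGeometry.AbsoluteAnabelian.AbsTopIChainsRigidity
import Literature.AnabelianGeometry.AbsoluteAnabelian.AbsTopIChainsSchemaClosures
import Literature.AnabelianGeometry.AbsoluteAnabelian.AbsTopI.SemiAbsoluteChains
import HarnessLib

/-!
# [AbsTopI] Def 4.2 (iv): morphisms of `Chain(Π)` are unique and commute with the operation
# homomorphisms (proof-only)

S. Mochizuki, *Topics in Absolute Anabelian Geometry I: Generalities* (2012) [AbsTopI] §4, Def 4.2
(iii)–(iv), pp. 49–50 (manuscript pagination, lit key `paper:url-11ac98ba15fc`).  Continuation of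
`AbsTopIChainsRigidity.lean`: the remaining clause of the bracket of Def 4.2 (iv), p. 50 l. 28–32,
"the condition of compatibility with the rigidifying homomorphisms implies [since all of the profinite
groups involved are slim] that every automorphism of a `Π`-chain is given by the identity, and that
every isomorphism of `Π`-chains is compatible with the respective operation homomorphisms", together
with the uniqueness statements it rests on:

* `ChainGroup.RigCompat.unique`: between two chain terms there is AT MOST ONE homomorphism that is
  open (as every operation homomorphism of Def 4.2 (iii) (a)–(d) is: open immersions and surjections
  of profinite groups, `isOpenMap_of_isOpen_range`) and compatible with the rigidifying homomorphisms
  (`RigCompat`, FACT-LIST row F-0215) — so the category `Chain(Π)` is thin and the operation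
  homomorphism of an elementary operation is determined by the two terms
  (`RigCompat.unique_of_isOpen_range`, `RigCompat.unique_of_surjective`);
* `ChainGroup.RigCompat.comp_eq_comp`: rigidification-compatible maps `e : Πⱼ → Ψⱼ`,
  `e' : Πⱼ₊₁ → Ψⱼ₊₁` intertwine the operation homomorphisms: `e' ∘ φ = ψ ∘ e` — the printed
  "compatible with the respective operation homomorphisms";
* in abc-iut-L4-t13's vocabulary of term isomorphisms over an isomorphism of extensions
  (`AbsTopI.ChainGroupIsoOver φ`, `AbsTopI/SemiAbsoluteChains.lean`): the isomorphism field is UNIQUE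
  (`ChainGroupIsoOver.iso_unique`), over `Iso.refl` an isomorphism of a term with itself is the
  identity (`ChainGroupIsoOver.iso_eq_refl`), and — for `G` slim, the standing hypothesis of Def 4.2
  (p. 47 l. 8) — a rigidification-compatible topological isomorphism is automatically a term
  isomorphism over `Iso.refl E`, its compatibility with the projections to `G` being a CONSEQUENCE
  (`ChainGroup.RigCompat.nonempty_chainGroupIsoOver`, via `RigCompat.proj_comp_apply`).

Topological-group input (our kernel check of a classical fact): a continuous homomorphism from a
compact group to a Hausdorff group WITH OPEN IMAGE is an open map (`isOpenMap_of_isOpen_range`).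
Proof-only (no `def`); the typers' files are imported, not edited.  Nothing here bears on [IUTchIII]
Cor 3.12; no side is taken.
-/

noncomputable section

open CategoryTheory Topology
open scoped Pointwise

universe u v

namespace Literature.AnabelianGeometry.AbsoluteAnabelian

open Literature.AlgebraicGeometry.Frobenioids (IsSlimGroup)

/-! ### Open homomorphisms of profinite groups -/

/-- A continuous homomorphism from a compact topological group to a Hausdorff topological group whose
image is OPEN is an open map: co-restricted to its image it is a closed, hence quotient, hence open
homomorphism, and the image is open.  (Covers the "open immersions" and the surjections of [AbsTopI]
Def 4.2 (iii) (a)–(d).) [cite: MochizukiAbsTopI2012, Def 4.2 (iii) p.50] -/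
theorem isOpenMap_of_isOpen_range {A : Type u} {B : Type v} [Group A] [TopologicalSpace A]
    [IsTopologicalGroup A] [CompactSpace A] [Group B] [TopologicalSpace B] [T2Space B]
    (f : A →ₜ* B) (h : IsOpen (Set.range f)) : IsOpenMap f := by
  let r : A →* f.toMonoidHom.range := f.toMonoidHom.rangeRestrict
  have hrc : Continuous r := continuous_induced_rng.2 (map_continuous f)
  have hro : IsOpenMap r :=
    (MonoidHom.isOpenQuotientMap_of_isQuotientMap (φ := r)
      (IsClosedMap.isQuotientMap hrc.isClosedMap hrc f.toMonoidHom.rangeRestrict_surjective)).isOpenMap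
  have hRo : IsOpen ((f.toMonoidHom.range : Subgroup B) : Set B) := by
    rw [MonoidHom.coe_range]
    exact h
  intro U hU
  have hUe : f '' U = Subtype.val '' (r '' U) := by
    rw [← Set.image_comp]
    rfl
  rw [hUe]
  exact hRo.isOpenMap_subtype_val _ (hro U hU)

/-- A continuous SURJECTIVE homomorphism from a compact group onto a Hausdorff group is open.
[cite: MochizukiAbsTopI2012, Def 4.2 (iii) p.50] -/
theorem isOpenMap_of_surjective {A : Type u} {B : Type v} [Group A] [TopologicalSpace A]
    [IsTopologicalGroup A] [CompactSpace A] [Group B] [TopologicalSpace B] [T2Space B]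
    (f : A →ₜ* B) (h : Function.Surjective f) : IsOpenMap f :=
  isOpenMap_of_isOpen_range f (by rw [Set.range_eq_univ.mpr h]; exact isOpen_univ)

/-- An open homomorphism carries open subgroups to open subgroups.
[cite: MochizukiAbsTopI2012, Def 4.2 (iii) p.50] -/
theorem isOpen_map_of_isOpenMap {A : Type u} {B : Type v} [Group A] [TopologicalSpace A]
    [Group B] [TopologicalSpace B] (f : A →* B) (hf : IsOpenMap f) (K : Subgroup A)
    (hK : IsOpen (K : Set A)) : IsOpen ((K.map f : Subgroup B) : Set B) := by
  rw [Subgroup.coe_map]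
  exact hf _ hK

namespace FundamentalExtension

namespace ChainGroup

variable {E : FundamentalExtension.{u}}

/-! ### Uniqueness of rigidification-compatible homomorphisms -/

/-- **`Chain(Π)` is thin.**  Two homomorphisms `Πⱼ → Ψ` of chain terms that are both compatible with
the rigidifying homomorphisms, one of them open, are EQUAL: they agree on the open subgroup
`ρⱼ(U ∩ U')` and `Ψ` is slim ([AbsTopI] Def 4.2 (iv) p. 50, "[since all of the profinite groups
involved are slim]"). [cite: MochizukiAbsTopI2012, Def 4.2 (iv) p.50] -/
theorem RigCompat.unique {L M : E.ChainGroup} {f f' : L.grp →ₜ* M.grp} (hf : RigCompat L M f)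
    (hf' : RigCompat L M f') (ho : IsOpenMap f) : f = f' := by
  obtain ⟨U, hUo, hU, hUM, h⟩ := hf
  obtain ⟨V, hVo, hV, hVM, h'⟩ := hf'
  -- the open subgroup `ρⱼ(U ∩ V)` of `Πⱼ`
  let W₀ : Subgroup L.dom := (U ⊓ V).comap L.dom.subtype
  have hW : IsOpen (((U ⊓ V : Subgroup E.arith)) : Set E.arith) := by
    rw [Subgroup.coe_inf]
    exact hUo.inter hVo
  have hW₀ : IsOpen (W₀ : Set L.dom) := by
    rw [Subgroup.coe_comap]
    exact hW.preimage continuous_subtype_val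
  have hHo := L.isOpen_map_rig W₀ hW₀
  have key := M.slim.eq_of_eqOn_of_isOpen_map f.toMonoidHom f'.toMonoidHom
    (isOpen_map_of_isOpenMap f.toMonoidHom ho) hHo (by
      rintro _ ⟨x, hx, rfl⟩
      have hxU : (x : E.arith) ∈ U := (Subgroup.mem_inf.1 hx).1
      have hxV : (x : E.arith) ∈ V := (Subgroup.mem_inf.1 hx).2
      change f (L.rig x) = f' (L.rig x)
      have e1 : L.rig x = L.rig ⟨x, hU hxU⟩ := rfl
      rw [e1, h ⟨x, hxU⟩]
      exact (h' ⟨x, hxV⟩).symm)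
  ext g
  exact key g

/-- Uniqueness for homomorphisms with OPEN IMAGE (open immersions `⋏`, `⋎` and surjections `•`, `⊚`
of [AbsTopI] Def 4.2 (iii) alike): the operation homomorphism of an elementary operation
`Πⱼ ⇝ Πⱼ₊₁` is determined by its two terms. [cite: MochizukiAbsTopI2012, Def 4.2 (iii) p.50] -/
theorem RigCompat.unique_of_isOpen_range {L M : E.ChainGroup} {f f' : L.grp →ₜ* M.grp}
    (hf : RigCompat L M f) (hf' : RigCompat L M f') (ho : IsOpen (Set.range f)) : f = f' :=
  hf.unique hf' (isOpenMap_of_isOpen_range f ho)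

/-- Uniqueness for SURJECTIVE operation homomorphisms (types `•`, `⊚`).
[cite: MochizukiAbsTopI2012, Def 4.2 (iii) p.50] -/
theorem RigCompat.unique_of_surjective {L M : E.ChainGroup} {f f' : L.grp →ₜ* M.grp}
    (hf : RigCompat L M f) (hf' : RigCompat L M f') (ho : Function.Surjective f) : f = f' :=
  hf.unique hf' (isOpenMap_of_surjective f ho)

/-! ### Def 4.2 (iv): isomorphisms of `Π`-chains commute with the operation homomorphisms -/

/-- **[AbsTopI] Def 4.2 (iv), "every isomorphism of `Π`-chains is compatible with the respective
operation homomorphisms"** (p. 50 l. 31–32): if `φ : Πⱼ → Πⱼ₊₁` and `ψ : Ψⱼ → Ψⱼ₊₁` are operation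
homomorphisms and `e : Πⱼ → Ψⱼ`, `e' : Πⱼ₊₁ → Ψⱼ₊₁` are compatible with the rigidifying
homomorphisms (all four `RigCompat`), with `e` and `ψ` open, then `e' ∘ φ = ψ ∘ e` — both composites
are rigidification-compatible maps `Πⱼ → Ψⱼ₊₁` (`rigCompat_comp`), hence equal (`RigCompat.unique`).
For an operation of type `⋏`, whose homomorphism points backwards, apply the lemma to
`φ : Πⱼ₊₁ → Πⱼ`. [cite: MochizukiAbsTopI2012, Def 4.2 (iv) p.50] -/
theorem RigCompat.comp_eq_comp {L L' M M' : E.ChainGroup} {φ : L.grp →ₜ* L'.grp}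
    {ψ : M.grp →ₜ* M'.grp} {e : L.grp →ₜ* M.grp} {e' : L'.grp →ₜ* M'.grp}
    (hφ : RigCompat L L' φ) (hψ : RigCompat M M' ψ) (he : RigCompat L M e)
    (he' : RigCompat L' M' e') (hoe : IsOpenMap e) (hoψ : IsOpenMap ψ) :
    e'.comp φ = ψ.comp e :=
  ((rigCompat_comp he hψ).unique (rigCompat_comp hφ he') (hoψ.comp hoe)).symm

/-- The same with openness supplied by open images (term isomorphisms and operation homomorphisms
all have open image). [cite: MochizukiAbsTopI2012, Def 4.2 (iv) p.50] -/
theorem RigCompat.comp_eq_comp_of_isOpen_range {L L' M M' : E.ChainGroup} {φ : L.grp →ₜ* L'.grp}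
    {ψ : M.grp →ₜ* M'.grp} {e : L.grp →ₜ* M.grp} {e' : L'.grp →ₜ* M'.grp}
    (hφ : RigCompat L L' φ) (hψ : RigCompat M M' ψ) (he : RigCompat L M e)
    (he' : RigCompat L' M' e') (hoe : IsOpen (Set.range e)) (hoψ : IsOpen (Set.range ψ)) :
    e'.comp φ = ψ.comp e :=
  hφ.comp_eq_comp hψ he he' (isOpenMap_of_isOpen_range e hoe) (isOpenMap_of_isOpen_range ψ hoψ)

/-- For `G` slim, a topological isomorphism of chain terms compatible with the rigidifying
homomorphisms IS a term isomorphism over `Iso.refl E` in the sense of abc-iut-L4-t13's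
`AbsTopI.ChainGroupIsoOver`: its compatibility with the projections to `G` is automatic
(`RigCompat.proj_comp_apply`). [cite: MochizukiAbsTopI2012, Def 4.2 (iv) p.50] -/
theorem RigCompat.nonempty_chainGroupIsoOver (hG : IsSlimGroup E.gal) {L M : E.ChainGroup}
    (e : L.grp ≃ₜ* M.grp) (h : RigCompat L M (e : L.grp →ₜ* M.grp)) :
    Nonempty (AbsTopI.ChainGroupIsoOver (Iso.refl E) L M) := by
  obtain ⟨U, hUo, hU, hUM, hφ⟩ := id h
  exact ⟨{ iso := e
           proj_comm := fun x => h.proj_comp_apply hG x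
           rig_comm := ⟨U, hUo, hU, by
             intro y hy
             obtain ⟨x, hx, rfl⟩ := hy
             exact hUM hx, fun x => hφ x⟩ }⟩

end ChainGroup

end FundamentalExtension

/-! ### In the vocabulary of `AbsTopI.ChainGroupIsoOver` -/

namespace AbsTopI.ChainGroupIsoOver

open FundamentalExtension

variable {E F : FundamentalExtension.{u}} {φ : E ≅ F} {L₁ : E.ChainGroup} {L₂ : F.ChainGroup}

/-- **Term isomorphisms over `φ` are unique**: two isomorphisms `Πⱼ ≅ Ψⱼ` over the same isomorphism
of extensions, both compatible with the rigidifying homomorphisms, coincide (they agree on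
`ρⱼ(U ∩ U')`; `Ψⱼ` is slim) — [AbsTopI] Def 4.2 (iv) p. 50, "[since all of the profinite groups
involved are slim]". [cite: MochizukiAbsTopI2012, Def 4.2 (iv) p.50] -/
theorem iso_unique (I J : ChainGroupIsoOver φ L₁ L₂) : I.iso = J.iso := by
  obtain ⟨U, hUo, hU₁, hU₂, hI⟩ := I.rig_comm
  obtain ⟨V, hVo, hV₁, hV₂, hJ⟩ := J.rig_comm
  let W₀ : Subgroup L₁.dom := (U ⊓ V).comap L₁.dom.subtype
  have hW : IsOpen (((U ⊓ V : Subgroup E.arith)) : Set E.arith) := by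
    rw [Subgroup.coe_inf]
    exact hUo.inter hVo
  have hW₀ : IsOpen (W₀ : Set L₁.dom) := by
    rw [Subgroup.coe_comap]
    exact hW.preimage continuous_subtype_val
  have hHo := L₁.isOpen_map_rig W₀ hW₀
  have hopen : ∀ K : Subgroup L₁.grp, IsOpen (K : Set L₁.grp) →
      IsOpen ((K.map I.iso.toMulEquiv.toMonoidHom : Subgroup L₂.grp) : Set L₂.grp) := fun K hK => by
    rw [Subgroup.coe_map]
    exact I.iso.toHomeomorph.isOpenMap _ hK
  have key := L₂.slim.eq_of_eqOn_of_isOpen_map I.iso.toMulEquiv.toMonoidHom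
    J.iso.toMulEquiv.toMonoidHom hopen hHo (by
      rintro _ ⟨x, hx, rfl⟩
      have hxU : (x : E.arith) ∈ U := (Subgroup.mem_inf.1 hx).1
      have hxV : (x : E.arith) ∈ V := (Subgroup.mem_inf.1 hx).2
      change I.iso (L₁.rig x) = J.iso (L₁.rig x)
      have e1 : L₁.rig x = L₁.rig ⟨x, hU₁ hxU⟩ := rfl
      rw [e1, hI ⟨x, hxU⟩]
      exact (hJ ⟨x, hxV⟩).symm)
  ext g
  exact key g

/-- **"Every automorphism of a `Π`-chain is given by the identity"** ([AbsTopI] Def 4.2 (iv) p. 50),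
termwise in abc-iut-L4-t13's vocabulary: an isomorphism of a chain term with itself over `Iso.refl E`
is the identity. [cite: MochizukiAbsTopI2012, Def 4.2 (iv) p.50] -/
theorem iso_eq_refl {L : E.ChainGroup} (I : ChainGroupIsoOver (Iso.refl E) L L) :
    I.iso = ContinuousMulEquiv.refl L.grp :=
  iso_unique I
    { iso := ContinuousMulEquiv.refl _
      proj_comm := fun _ => rfl
      rig_comm := ⟨L.dom, L.isOpen_dom, le_rfl, by
        intro y hy
        obtain ⟨x, hx, rfl⟩ := hy
        exact hx, fun _ => rfl⟩ }

/-- Hence two isomorphic `Π`-chains over `φ` are isomorphic in exactly one way at each term: the type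
of term isomorphisms over `φ` is a subsingleton up to the (proof-irrelevant) compatibility fields.
[cite: MochizukiAbsTopI2012, Def 4.2 (iv) p.50] -/
theorem iso_apply_eq (I J : ChainGroupIsoOver φ L₁ L₂) (x : L₁.grp) : I.iso x = J.iso x := by
  rw [iso_unique I J]

end AbsTopI.ChainGroupIsoOver

end Literature.AnabelianGeometry.AbsoluteAnabelian

end
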